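import Literature.NumberTheory.EllipticCurves.CyclotomicZpExtensionLayerTwoProofs
import Literature.NumberTheory.EllipticCurves.ZpExtensionUnitTwistProofs
import HarnessLib

/-!
# The `n`-th layer of the cyclotomic `ℤ₂`-extension of `ℚ` contains `ζ_{2^{n+2}} + ζ_{2^{n+2}}⁻¹`
# (`ℚ_n = ℚ(ζ_{2^{n+2}})⁺`); in particular `ℚ_2 ∋ √(2+√2)`, a root of `X⁴ − 4X² + 2` — proofs only

Topic `NumberTheory/EllipticCurves` (sibling of `CyclotomicZpExtensionLayerOneSqrtTwoProofs.lean`, the case `n = 1`: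
`√2 = ζ₈ + ζ₈⁻¹ ∈ ℚ_1`, and of `CyclotomicZpExtensionLayerTwoProofs.lean`, the inclusion `ℚ_n ⊆ ℚ(μ_{2^{n+2}})`).
Seat `cruxlead-stmt-BirchSwinnertonDyer-19573-w2` GEN 10 (cell `bsd-2adic`; `--supports` stmt-BirchSwinnertonDyer-19573;
closes nothing).  Consumer: the layer-`2` model `K_2 ≅ K(√(2+√2))` of an odd-degree number field `K` in the narrow rank
certificate of NARROW FUKUDA (`IwasawaTheory/NarrowFukudaCertificateLayerTwoModel.lean`), i.e. the `n = 1` rung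
«`rank₂ Cl⁺(K_2) = rank₂ Cl⁺(K_1)`» for fields whose narrow `2`-rank grows once between `K` and `K(√2)`.

## Statements (no definitions, no named facts)

* `CyclotomicZp.norm_sq_sub_one_le_of_pow_dvd_ell` — for a unit `u` of `ℤ₂` with `2ⁿ ∣ ℓ(u)` (`ℓ` the normalised
  logarithm of `CyclotomicZpExtension.lean`, `γ_cyc = 5`, `5^{2ℓ(u)} = u²`): `‖u² − 1‖ ≤ ‖2^{n+3}‖`, from
  `‖5^y − 1‖ = ‖y‖·‖4‖` (Serre, *Cours d'arithmétique* II.3.2) with `y = 2ℓ(u) ∈ 2^{n+1}ℤ₂`.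
* `CyclotomicZp.pow_dvd_sub_one_or_pow_dvd_add_one` — `2 ∣ u − 1` and `2^{n+3} ∣ u² − 1` in `ℤ₂` give
  `2^{n+2} ∣ u − 1` or `2^{n+2} ∣ u + 1` (`u − 1 = 2a`, `u + 1 = 2(a+1)`, one of `a`, `a + 1` is a unit); hence
  `CyclotomicZp.pow_dvd_sub_one_or_pow_dvd_add_one_of_pow_dvd_ell`: **`2ⁿ ∣ ℓ(u) ⟹ u ≡ ±1 (mod 2^{n+2})`**.
* `CyclotomicZp.smul_eq_self_or_eq_inv_of_mem_layerSubgroup` — every `σ ∈ Gal(ℚ̄/ℚ_n) = κ_cyc⁻¹(2ⁿℤ₂)` maps a primitive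
  `2^{n+2}`-th root of unity `ζ` to `ζ^{±1}` (`GaloisRep.cyclotomicCharacter_spec`), so it FIXES `ζ + ζ⁻¹`
  (`smul_add_inv_of_mem_layerSubgroup`), i.e. **`ζ + ζ⁻¹ ∈ ℚ_n`** (`add_inv_mem_layer_zpExtension`); the same for
  EVERY cyclotomic `κ : ZpExtension ℚ 2` (`ZpExtension.IsCyclotomic.add_inv_mem_layer`: `κ` is a unit twist of
  `κ_cyc`, unit twists do not move the layers).  With `[ℚ_n : ℚ] = 2ⁿ = [ℚ(ζ + ζ⁻¹) : ℚ]` this is Washington's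
  `ℚ_n = ℚ(ζ_{2^{n+2}})⁺` (the degree comparison is not needed by the consumer and is not typed here).
* `n = 2`: for a primitive `16`-th root of unity `ζ`, `t = ζ + ζ⁻¹ = 2cos(π/8) = √(2+√2)` satisfies
  `(t² − 2)² = 2` (`sq_sq_add_inv_sub_two_eq_two`) and `t⁴ − 4t² + 2 = 0` (`quartic_add_inv_eq_zero`), whence
  **`ZpExtension.IsCyclotomic.exists_quartic_root_layer_two`: `∃ θ ∈ ℚ_2 = κ.layer 2, θ⁴ − 4θ² + 2 = 0`** for every
  cyclotomic `κ : ZpExtension ℚ 2`.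

References: L. C. Washington, *Introduction to Cyclotomic Fields*, 2nd ed. (1997), §13.1 (`ℚ_∞ ⊂ ℚ(μ_{2^∞})` is the fixed
field of `{±1}`; `ℚ_n = ℚ(ζ_{2^{n+2}})⁺`; `ℚ_1 = ℚ(√2)`) [Washington1997]; J.-P. Serre, *A Course in Arithmetic*, Ch. II §3.2
Prop. 8 (`ℤ₂ˣ = {±1} × (1 + 4ℤ₂)`, `1 + 4ℤ₂ = 5^{ℤ₂}`) [Serre1973].

Design: proofs only; `noncomputable section`; file-local helpers `private`; the `2`-adic step is phrased with divisibility in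
`ℤ₂` (no residues `mod 2^{n+2}` computed by `decide`, so every `n` is covered).
-/

noncomputable section

open scoped NumberField
open Field
open Literature.NumberTheory.GaloisRepresentations
open Literature.NumberTheory.EllipticCurves Literature.NumberTheory.EllipticCurves.PadicOneUnits

namespace Literature.NumberTheory.EllipticCurves.CyclotomicZp

/-- At `p = 2` the cyclotomic exponent is `2` (`γ_cyc = 1 + 2² = 5`). [folklore] -/
private theorem cyclotomicExponent_two'' : cyclotomicExponent 2 = 2 := by
  unfold cyclotomicExponent; simp

/-- At `p = 2` the torsion order `#μ(ℤ₂)` is `2`. [folklore] -/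
private theorem torsionOrder_two'' : torsionOrder 2 = 2 := by
  rw [torsionOrder, cyclotomicExponent_two'']; decide

/-! ## §1 The `2`-adic step: `2ⁿ ∣ ℓ(u) ⟹ u ≡ ±1 (mod 2^{n+2})` -/

/-- **`2ⁿ ∣ ℓ(u) ⇒ u² ≡ 1 (mod 2^{n+3})`** for a unit `u` of `ℤ₂`: with `y = 2ℓ(u) ∈ 2^{n+1}ℤ₂` and `5^y = u²`,
`‖u² − 1‖ = ‖5^y − 1‖ = ‖y‖·‖4‖ ≤ ‖2^{n+3}‖`. [cite: Serre1973, Ch. II §3.2 Prop. 8] -/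
theorem norm_sq_sub_one_le_of_pow_dvd_ell (u : ℤ_[2]ˣ) (n : ℕ) (h : (2 : ℤ_[2]) ^ n ∣ ell 2 u) :
    ‖(u : ℤ_[2]) ^ 2 - 1‖ ≤ ‖(2 : ℤ_[2]) ^ (n + 3)‖ := by
  set y : ℤ_[2] := torsionOrder 2 * ell 2 u with hy
  have h1 : cycPow 2 y = (u : ℤ_[2]) ^ torsionOrder 2 := cycPow_torsionOrder_mul_ell 2 u
  have h2 : ‖cycPow 2 y - 1‖ = ‖y‖ * ‖((2 : ℕ) : ℤ_[2]) ^ (cyclotomicExponent 2 - 1 + 1)‖ :=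
    norm_oneAddPow_sub_one (p := 2) (cyclotomicExponent 2 - 1) (cyclotomicExponent_cond 2) y
  rw [cyclotomicExponent_two'', show (2 - 1 + 1 : ℕ) = 2 from rfl, Nat.cast_ofNat] at h2
  obtain ⟨x, hx⟩ := h
  have hy' : y = (2 : ℤ_[2]) ^ (n + 1) * x := by
    rw [hy, hx, torsionOrder_two'', Nat.cast_ofNat]; ring
  have hny : ‖y‖ ≤ ‖(2 : ℤ_[2]) ^ (n + 1)‖ := by
    rw [hy', norm_mul]
    exact mul_le_of_le_one_right (norm_nonneg _) (PadicInt.norm_le_one x)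
  rw [torsionOrder_two''] at h1
  calc ‖(u : ℤ_[2]) ^ 2 - 1‖ = ‖y‖ * ‖(2 : ℤ_[2]) ^ 2‖ := by rw [← h1, h2]
    _ ≤ ‖(2 : ℤ_[2]) ^ (n + 1)‖ * ‖(2 : ℤ_[2]) ^ 2‖ :=
        mul_le_mul_of_nonneg_right hny (norm_nonneg _)
    _ = ‖(2 : ℤ_[2]) ^ (n + 3)‖ := by rw [← norm_mul, ← pow_add]

/-- A unit of `ℤ₂` is `≡ 1 (mod 2)`: `2 ∣ u − 1` (the residue field is `𝔽₂`, whose only unit is `1`; `ℤ₂ˣ = {±1} × (1 + 4ℤ₂) ⊆ 1 + 2ℤ₂`).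
[cite: Serre1973, Ch. II §3.2 Prop. 8] -/
theorem two_dvd_sub_one (u : ℤ_[2]ˣ) : (2 : ℤ_[2]) ∣ (u : ℤ_[2]) - 1 := by
  have hunit : IsUnit (PadicInt.toZMod (u : ℤ_[2])) := (Units.isUnit u).map _
  have hne : PadicInt.toZMod (u : ℤ_[2]) ≠ 0 := hunit.ne_zero
  have hall : ∀ x : ZMod 2, x ≠ 0 → x = 1 := by decide
  have h1 : PadicInt.toZMod ((u : ℤ_[2]) - 1) = 0 := by
    rw [map_sub, map_one, hall _ hne, sub_self]
  have hmem : (u : ℤ_[2]) - 1 ∈ RingHom.ker (PadicInt.toZMod : ℤ_[2] →+* ZMod 2) := h1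
  rw [PadicInt.ker_toZMod, PadicInt.maximalIdeal_eq_span_p, Ideal.mem_span_singleton] at hmem
  exact_mod_cast hmem

/-- An element of `ℤ₂` not divisible by `2` is a unit (`‖a‖ = 1`). [folklore] -/
private theorem isUnit_of_not_two_dvd {a : ℤ_[2]} (ha : ¬ (2 : ℤ_[2]) ∣ a) : IsUnit a := by
  rw [PadicInt.isUnit_iff]
  have h1 : ¬ ‖a‖ < 1 := fun h => ha (by exact_mod_cast (PadicInt.norm_lt_one_iff_dvd a).mp h)
  exact le_antisymm (PadicInt.norm_le_one a) (not_lt.mp h1)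

/-- **`2 ∣ u − 1` and `2^{n+3} ∣ u² − 1` ⟹ `2^{n+2} ∣ u − 1` or `2^{n+2} ∣ u + 1`** in `ℤ₂`: writing `u − 1 = 2a`,
`u + 1 = 2(a + 1)` and `u² − 1 = 4a(a+1)` with one of `a`, `a + 1` a unit. [cite: Serre1973, Ch. II §3.2 Prop. 8] -/
theorem pow_dvd_sub_one_or_pow_dvd_add_one {u : ℤ_[2]} {n : ℕ} (hu : (2 : ℤ_[2]) ∣ u - 1)
    (h : (2 : ℤ_[2]) ^ (n + 3) ∣ u ^ 2 - 1) :
    (2 : ℤ_[2]) ^ (n + 2) ∣ u - 1 ∨ (2 : ℤ_[2]) ^ (n + 2) ∣ u + 1 := by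
  obtain ⟨a, ha⟩ := hu
  have hu1 : u - 1 = 2 * a := ha
  have hu2 : u + 1 = 2 * (a + 1) := by linear_combination ha
  have hsq : u ^ 2 - 1 = (2 : ℤ_[2]) ^ 2 * (a * (a + 1)) := by
    have : u ^ 2 - 1 = (u - 1) * (u + 1) := by ring
    rw [this, hu1, hu2]; ring
  have h' : (2 : ℤ_[2]) ^ (n + 1) ∣ a * (a + 1) := by
    have h2 : (2 : ℤ_[2]) ^ 2 * (2 : ℤ_[2]) ^ (n + 1) ∣ (2 : ℤ_[2]) ^ 2 * (a * (a + 1)) := by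
      rw [← pow_add, show 2 + (n + 1) = n + 3 by ring, ← hsq]; exact h
    exact (mul_dvd_mul_iff_left (pow_ne_zero 2 two_ne_zero)).mp h2
  by_cases h2a : (2 : ℤ_[2]) ∣ a
  · -- `a + 1` is a unit
    obtain ⟨y, hy⟩ := h2a
    have hunit : IsUnit (a + 1) := by
      rw [PadicInt.isUnit_iff, hy, add_comm]
      exact_mod_cast norm_one_add_p_mul (p := 2) y
    left
    rw [hu1, pow_succ, mul_comm _ (2 : ℤ_[2])]
    exact mul_dvd_mul_left 2 ((hunit.dvd_mul_right).mp h')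
  · -- `a` is a unit
    have hunit : IsUnit a := isUnit_of_not_two_dvd h2a
    right
    rw [hu2, pow_succ, mul_comm _ (2 : ℤ_[2])]
    exact mul_dvd_mul_left 2 ((hunit.dvd_mul_left).mp h')

/-- **`2ⁿ ∣ ℓ(u) ⟹ u ≡ ±1 (mod 2^{n+2})`** for a unit `u` of `ℤ₂`: `log₂` maps `±(1 + 2^{n+2}ℤ₂)` onto
`2^{n+2}ℤ₂ = 2ⁿ·log₂(5)ℤ₂`. [cite: Serre1973, Ch. II §3.2 Prop. 8] [cite: Washington1997, §13.1] -/
theorem pow_dvd_sub_one_or_pow_dvd_add_one_of_pow_dvd_ell (u : ℤ_[2]ˣ) (n : ℕ)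
    (h : (2 : ℤ_[2]) ^ n ∣ ell 2 u) :
    (2 : ℤ_[2]) ^ (n + 2) ∣ (u : ℤ_[2]) - 1 ∨ (2 : ℤ_[2]) ^ (n + 2) ∣ (u : ℤ_[2]) + 1 :=
  pow_dvd_sub_one_or_pow_dvd_add_one (two_dvd_sub_one u)
    (dvd_of_norm_le (pow_ne_zero _ two_ne_zero) (norm_sq_sub_one_le_of_pow_dvd_ell u n h))

/-! ## §2 `Gal(ℚ̄/ℚ_n)` fixes `ζ_{2^{n+2}} + ζ_{2^{n+2}}⁻¹` -/

/-- **Every `σ ∈ Gal(ℚ̄/ℚ_n) = κ_cyc⁻¹(2ⁿℤ₂)` maps a primitive `2^{n+2}`-th root of unity `ζ` to `ζ` or to `ζ⁻¹`**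
(`χ₂(σ) ≡ ±1 (mod 2^{n+2})` by §1, and `σ ζ = ζ^{χ₂(σ) mod 2^{n+2}}`). [cite: Washington1997, §13.1] -/
theorem smul_eq_self_or_eq_inv_of_mem_layerSubgroup {n : ℕ} {σ : absoluteGaloisGroup ℚ}
    (hσ : σ ∈ (zpExtension 2).layerSubgroup n) {ζ : AlgebraicClosure ℚ}
    (hζ : IsPrimitiveRoot ζ (2 ^ (n + 2))) : σ • ζ = ζ ∨ σ • ζ = ζ⁻¹ := by
  rw [ZpExtension.mem_layerSubgroup, zpExtension_apply, toAdd_ofAdd] at hσ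
  set u : ℤ_[2]ˣ := GaloisRep.cyclotomicCharacter ℚ 2 σ with hu
  have hspec := GaloisRep.cyclotomicCharacter_spec ℚ 2 (k := n + 2) σ ζ hζ.pow_eq_one
  rw [← hu] at hspec
  haveI : NeZero (2 ^ (n + 2) : ℕ) := ⟨pow_ne_zero _ two_ne_zero⟩
  rcases pow_dvd_sub_one_or_pow_dvd_add_one_of_pow_dvd_ell u n hσ with h1 | h1
  · -- `u ≡ 1`: `σ ζ = ζ`
    left
    have hker : (u : ℤ_[2]) - 1 ∈ RingHom.ker (PadicInt.toZModPow (p := 2) (n + 2)) := by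
      rw [PadicInt.ker_toZModPow, Ideal.mem_span_singleton]; exact h1
    have hval : PadicInt.toZModPow (p := 2) (n + 2) (u : ℤ_[2]) = 1 := by
      rw [RingHom.mem_ker, map_sub, map_one, sub_eq_zero] at hker; exact hker
    have hdvd : 2 ^ (n + 2) ∣ (PadicInt.toZModPow (p := 2) (n + 2) (u : ℤ_[2])).val + (2 ^ (n + 2) - 1) := by
      rw [← ZMod.natCast_eq_zero_iff, Nat.cast_add, ZMod.natCast_zmod_val, hval]
      have h22 : ((2 ^ (n + 2) - 1 : ℕ) : ZMod (2 ^ (n + 2))) + 1 = 0 := by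
        rw [← Nat.cast_add_one, Nat.sub_add_cancel (Nat.one_le_two_pow), ZMod.natCast_self]
      linear_combination h22
    -- `ζ^{val} · ζ^{2^{n+2}-1} = 1` and `ζ · ζ^{2^{n+2}-1} = 1`
    have hz1 : ζ * ζ ^ (2 ^ (n + 2) - 1) = 1 := by
      rw [← pow_succ', Nat.sub_add_cancel (Nat.one_le_two_pow), hζ.pow_eq_one]
    have hz2 : ζ ^ (PadicInt.toZModPow (p := 2) (n + 2) (u : ℤ_[2])).val * ζ ^ (2 ^ (n + 2) - 1) = 1 := by
      rw [← pow_add, hζ.pow_eq_one_iff_dvd]; exact hdvd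
    rw [hspec]
    have hne : ζ ^ (2 ^ (n + 2) - 1) ≠ 0 := by
      intro h0; rw [h0, mul_zero] at hz1; exact zero_ne_one hz1
    exact mul_right_cancel₀ hne (hz2.trans hz1.symm)
  · -- `u ≡ −1`: `σ ζ = ζ⁻¹`
    right
    have hker : (u : ℤ_[2]) + 1 ∈ RingHom.ker (PadicInt.toZModPow (p := 2) (n + 2)) := by
      rw [PadicInt.ker_toZModPow, Ideal.mem_span_singleton]; exact h1
    have hval : PadicInt.toZModPow (p := 2) (n + 2) (u : ℤ_[2]) + 1 = 0 := by
      rw [RingHom.mem_ker, map_add, map_one] at hker; exact hker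
    have hdvd : 2 ^ (n + 2) ∣ (PadicInt.toZModPow (p := 2) (n + 2) (u : ℤ_[2])).val + 1 := by
      rw [← ZMod.natCast_eq_zero_iff, Nat.cast_add, ZMod.natCast_zmod_val, Nat.cast_one]
      exact hval
    have hz : ζ ^ (PadicInt.toZModPow (p := 2) (n + 2) (u : ℤ_[2])).val * ζ = 1 := by
      rw [← pow_succ, hζ.pow_eq_one_iff_dvd]; exact hdvd
    rw [hspec]
    exact eq_inv_of_mul_eq_one_left hz

/-- **Every `σ ∈ Gal(ℚ̄/ℚ_n)` fixes `ζ + ζ⁻¹`** (`ζ` a primitive `2^{n+2}`-th root of unity). [cite: Washington1997, §13.1] -/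
theorem smul_add_inv_of_mem_layerSubgroup {n : ℕ} {σ : absoluteGaloisGroup ℚ}
    (hσ : σ ∈ (zpExtension 2).layerSubgroup n) {ζ : AlgebraicClosure ℚ}
    (hζ : IsPrimitiveRoot ζ (2 ^ (n + 2))) : σ • (ζ + ζ⁻¹) = ζ + ζ⁻¹ := by
  rw [smul_add, smul_inv'']
  rcases smul_eq_self_or_eq_inv_of_mem_layerSubgroup hσ hζ with h | h
  · rw [h]
  · rw [h, inv_inv, add_comm]

/-- **`ζ_{2^{n+2}} + ζ_{2^{n+2}}⁻¹ ∈ ℚ_n`** for the normalised cyclotomic `ℤ₂`-extension of `ℚ`: the `n`-th layer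
`ℚ_n = ℚ̄^{κ_cyc⁻¹(2ⁿℤ₂)}` contains `ζ + ζ⁻¹` for every primitive `2^{n+2}`-th root of unity `ζ ∈ ℚ̄`
(`ℚ_n = ℚ(ζ_{2^{n+2}})⁺`). [cite: Washington1997, §13.1] -/
theorem add_inv_mem_layer_zpExtension (n : ℕ) {ζ : AlgebraicClosure ℚ} (hζ : IsPrimitiveRoot ζ (2 ^ (n + 2))) :
    ζ + ζ⁻¹ ∈ (zpExtension 2).layer n := by
  change ζ + ζ⁻¹ ∈ IntermediateField.fixedField _
  rw [IntermediateField.mem_fixedField_iff]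
  rintro _ ⟨σ, hσ, rfl⟩
  exact smul_add_inv_of_mem_layerSubgroup hσ hζ

/-- There is a primitive `2^{n+2}`-th root of unity `ζ ∈ ℚ̄` with `ζ + ζ⁻¹ ∈ ℚ_n` (normalised `κ_cyc`).
[cite: Washington1997, §13.1] -/
theorem exists_isPrimitiveRoot_add_inv_mem_layer_zpExtension (n : ℕ) :
    ∃ ζ : AlgebraicClosure ℚ, IsPrimitiveRoot ζ (2 ^ (n + 2)) ∧ ζ + ζ⁻¹ ∈ (zpExtension 2).layer n := by
  haveI : NeZero (2 ^ (n + 2) : ℕ) := ⟨pow_ne_zero _ two_ne_zero⟩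
  obtain ⟨ζ, hζ⟩ := HasEnoughRootsOfUnity.exists_primitiveRoot (AlgebraicClosure ℚ) (2 ^ (n + 2))
  exact ⟨ζ, hζ, add_inv_mem_layer_zpExtension n hζ⟩

/-! ## §3 `n = 2`: `ζ₁₆ + ζ₁₆⁻¹ = √(2+√2)` is a root of `X⁴ − 4X² + 2` -/

/-- For a primitive `16`-th root of unity `ζ`: `ζ⁸ = −1`. [folklore] -/
private theorem pow_eight_eq_neg_one {F : Type*} [Field F] {ζ : F} (hζ : IsPrimitiveRoot ζ (2 ^ 4)) :
    ζ ^ 8 = -1 := by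
  have h16 : ζ ^ 16 = 1 := by simpa using hζ.pow_eq_one
  have h8 : ζ ^ 8 ≠ 1 := hζ.pow_ne_one_of_pos_of_lt (by norm_num) (by norm_num)
  have hsq : ζ ^ 8 * ζ ^ 8 = 1 := by rw [← pow_add]; exact h16
  rcases mul_self_eq_one_iff.mp hsq with h | h
  · exact (h8 h).elim
  · exact h

/-- For a primitive `16`-th root of unity `ζ`: `ζ⁻¹ = ζ¹⁵`. [folklore] -/
private theorem inv_eq_pow_fifteen {F : Type*} [Field F] {ζ : F} (hζ : IsPrimitiveRoot ζ (2 ^ 4)) :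
    ζ⁻¹ = ζ ^ 15 := by
  have h16 : ζ ^ 16 = 1 := by simpa using hζ.pow_eq_one
  have h : ζ * ζ ^ 15 = 1 := by rw [← pow_succ']; exact h16
  exact (eq_inv_of_mul_eq_one_right h).symm

/-- **`((ζ + ζ⁻¹)² − 2)² = 2`** for a primitive `16`-th root of unity `ζ`: `(ζ + ζ⁻¹)² − 2 = ζ² + ζ⁻² = ζ₈ + ζ₈⁻¹ = √2`.
So `ζ₁₆ + ζ₁₆⁻¹ = √(2 + √2)` and `ℚ_2 = ℚ(ζ₁₆)⁺ = ℚ(√(2+√2))`. [cite: Washington1997, §13.1] -/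
theorem sq_sq_add_inv_sub_two_eq_two {F : Type*} [Field F] {ζ : F} (hζ : IsPrimitiveRoot ζ (2 ^ 4)) :
    ((ζ + ζ⁻¹) ^ 2 - 2) ^ 2 = 2 := by
  have h16 : ζ ^ 16 = 1 := by simpa using hζ.pow_eq_one
  have h8 : ζ ^ 8 = -1 := pow_eight_eq_neg_one hζ
  rw [inv_eq_pow_fifteen hζ]
  have hA : (ζ + ζ ^ 15) ^ 2 - 2 = ζ ^ 2 + ζ ^ 14 := by
    have e : (ζ + ζ ^ 15) ^ 2 - 2 = ζ ^ 2 + ζ ^ 14 * ζ ^ 16 + 2 * (ζ ^ 16 - 1) := by ring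
    rw [e, h16]; ring
  have hB : (ζ ^ 2 + ζ ^ 14) ^ 2 = 2 := by
    have e : (ζ ^ 2 + ζ ^ 14) ^ 2 = ζ ^ 4 * (1 + ζ ^ 8) + 2 * ζ ^ 16 + ζ ^ 12 * (ζ ^ 16 - 1) := by ring
    rw [e, h16, h8]; ring
  rw [hA, hB]

/-- **`t⁴ − 4t² + 2 = 0` for `t = ζ₁₆ + ζ₁₆⁻¹`** (`ζ` a primitive `16`-th root of unity): the minimal polynomial of
`2cos(π/8) = √(2+√2)` over `ℚ` is `X⁴ − 4X² + 2` (Eisenstein at `2`). [cite: Washington1997, §13.1] -/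
theorem quartic_add_inv_eq_zero {F : Type*} [Field F] {ζ : F} (hζ : IsPrimitiveRoot ζ (2 ^ 4)) :
    (ζ + ζ⁻¹) ^ 4 - 4 * (ζ + ζ⁻¹) ^ 2 + 2 = 0 := by
  have h := sq_sq_add_inv_sub_two_eq_two hζ
  linear_combination h

/-- **`∃ t ∈ ℚ_2` with `t⁴ − 4t² + 2 = 0`** (and `(t² − 2)² = 2`) for the normalised cyclotomic `ℤ₂`-extension of `ℚ`:
`t = ζ₁₆ + ζ₁₆⁻¹`. [cite: Washington1997, §13.1] -/
theorem exists_mem_layer_two_quartic_zpExtension :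
    ∃ t : AlgebraicClosure ℚ, t ∈ (zpExtension 2).layer 2 ∧ (t ^ 2 - 2) ^ 2 = 2 ∧ t ^ 4 - 4 * t ^ 2 + 2 = 0 := by
  obtain ⟨ζ, hζ, hmem⟩ := exists_isPrimitiveRoot_add_inv_mem_layer_zpExtension 2
  exact ⟨ζ + ζ⁻¹, hmem, sq_sq_add_inv_sub_two_eq_two hζ, quartic_add_inv_eq_zero hζ⟩

end Literature.NumberTheory.EllipticCurves.CyclotomicZp

namespace Literature.NumberTheory.EllipticCurves.ZpExtension

/-- **`ζ_{2^{n+2}} + ζ_{2^{n+2}}⁻¹ ∈ ℚ_n` for EVERY cyclotomic `ℤ₂`-extension `κ` of `ℚ`** (`κ` is a unit twist of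
`κ_cyc`, and unit twists do not move the layers): for every primitive `2^{n+2}`-th root of unity `ζ ∈ ℚ̄`,
`ζ + ζ⁻¹ ∈ κ.layer n`. [cite: Washington1997, §13.1] -/
theorem IsCyclotomic.add_inv_mem_layer {κ : ZpExtension ℚ 2} (hκ : κ.IsCyclotomic) (n : ℕ)
    {ζ : AlgebraicClosure ℚ} (hζ : IsPrimitiveRoot ζ (2 ^ (n + 2))) : ζ + ζ⁻¹ ∈ κ.layer n := by
  obtain ⟨u, rfl⟩ := IsCyclotomic.exists_eq_unitTwist_holds
    (CyclotomicZp.isCyclotomic_zpExtension 2) hκ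
  have hlayer : ((CyclotomicZp.zpExtension 2).unitTwist u).layer n =
      (CyclotomicZp.zpExtension 2).layer n := by
    unfold ZpExtension.layer
    rw [layerSubgroup_unitTwist]
  rw [hlayer]
  exact CyclotomicZp.add_inv_mem_layer_zpExtension n hζ

/-- **`∃ θ : ℚ_2` with `θ⁴ − 4θ² + 2 = 0` for EVERY cyclotomic `ℤ₂`-extension `κ` of `ℚ`** (`θ = ζ₁₆ + ζ₁₆⁻¹ = √(2+√2)`;
with `[ℚ_2 : ℚ] = 4` this is `ℚ_2 = ℚ(ζ₁₆)⁺`) — the layer-`2` twin of `IsCyclotomic.exists_sq_eq_two_layer_one`.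
[cite: Washington1997, §13.1] -/
theorem IsCyclotomic.exists_quartic_root_layer_two {κ : ZpExtension ℚ 2} (hκ : κ.IsCyclotomic) :
    ∃ θ : κ.layer 2, θ ^ 4 - 4 * θ ^ 2 + 2 = 0 := by
  haveI : NeZero (2 ^ (2 + 2) : ℕ) := ⟨pow_ne_zero _ two_ne_zero⟩
  obtain ⟨ζ, hζ⟩ := HasEnoughRootsOfUnity.exists_primitiveRoot (AlgebraicClosure ℚ) (2 ^ (2 + 2))
  have hmem := IsCyclotomic.add_inv_mem_layer hκ 2 hζ
  refine ⟨⟨ζ + ζ⁻¹, hmem⟩, Subtype.ext ?_⟩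
  change (ζ + ζ⁻¹) ^ 4 - 4 * (ζ + ζ⁻¹) ^ 2 + 2 = (0 : AlgebraicClosure ℚ)
  exact CyclotomicZp.quartic_add_inv_eq_zero hζ

/-- The same with the intermediate square root recorded: `∃ θ : ℚ_2`, `(θ² − 2)² = 2` (so `θ² − 2` is a square root of `2`
in `ℚ_2`, in fact in `ℚ_1`) and `θ⁴ − 4θ² + 2 = 0`. [cite: Washington1997, §13.1] -/
theorem IsCyclotomic.exists_sq_sq_sub_two_layer_two {κ : ZpExtension ℚ 2} (hκ : κ.IsCyclotomic) :
    ∃ θ : κ.layer 2, (θ ^ 2 - 2) ^ 2 = 2 ∧ θ ^ 4 - 4 * θ ^ 2 + 2 = 0 := by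
  obtain ⟨θ, hθ⟩ := IsCyclotomic.exists_quartic_root_layer_two hκ
  exact ⟨θ, by linear_combination hθ, hθ⟩

end Literature.NumberTheory.EllipticCurves.ZpExtension

end
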